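/-
Copyright (c) 2026 the pub-hodgecm-mathlib formalisation cell (harness21).  Prover seat hodgecm-mathlib-K2Liu-p02 (g7), Track B «K2-LIT» ∕ hLiu418
#184♮, Road Φ ∕ socket #41, organ G5-a (Φ7-2), face (β0), sub-organ (β0-1a) FILE B (LEAD F0P6-plan (g14) BATCH #6 2026-09-04T12:03:02Z (6)
«B-hyp NOW, B-def filed after C»; since ★ `K2LiuUnipotentChart.exists_unipChart` already gives GLOBAL coordinates on `N_Δ(𝔸)`, the letters are PROVED, not taken).
THEOREMS ONLY.
-/
import Summits.HodgeConjecture.HodgeConjecture.Theorems.K2LiuUnipotentChart                 -- ★ `exists_unipChart`, `skew_of_mem_unipDelta`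
import Summits.HodgeConjecture.HodgeConjecture.Theorems.K2LiuSiegelMiddleCellLeviCriterion   -- ★ α2d-1: `exists_gramR_eq_diagonal`
import Summits.HodgeConjecture.HodgeConjecture.Theorems.K2LiuSiegelUnipotentCharacters      -- ★ `toBlocks₁₂_blk_mul ∕ _one ∕ _inv`, `continuous_toBlocks₁₂_blk` (reused BY NAME, not restated)
import Literature.NumberTheory.Automorphic.DoubledUnitaryBorelDiag                          -- ★ `conjAdele_delta_mul_baseChange_add` (+ ★ `QuadraticAdeleBaseChange.quadraticAdeleEquiv`)
import HarnessLib

/-!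
# Crux `HLiu418`, Road Φ, face (β0-1a), FILE B: CORNER COORDINATES ON `N_Δ(𝔸)` — the frame coordinate `X_u = (blk u)₁₂` is additive, continuous and
# rational on rational points; at `n = 2` its diagonal entries are anti-invariant, the corner line `x ↦ (0 0; 0 x)` (`σx = −x`) is skew, and the anti-invariant
# adeles are `(𝔸_{L⁺} ⊗ 1) · δ` with a continuous coordinate

Cell `hodgecm-mathlib`, crux item hLiu418 = `stmt-HodgeConjecture-24832`; squad K2 ∕ K2Liu; prover K2Liu-p02 (g7).  THEOREMS ONLY (no `def`, no instance, no
notation, no named-fact hypothesis, no `sorry`); lane `--supports stmt-HodgeConjecture-24832 --as helper`.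

WHY (the (β0-1a) chain, K2Liu-p02 (g7) census 2026-09-04T11:59Z, LEAD BATCH #6 (6) «=»).  FILE A ★∕📤 `K2LiuCoveringWeightSemidirectUnfold` unfolds a covering weight along
`B = A · Z` abstractly; FILE C instantiates it at `B = N_Δ(𝔸)`, `Z = N_χ(𝔸) = {u : (X_u)₁₁ = 0}` (★ α2d-2 `stabilizer_reflStd_iff`), `A =` the corner line
`n₂(𝔸_{L⁺})`, `n₂ t = n((0 0; 0 (t⊗1)δ))` (★ `exists_unipChart`).  This file supplies the coordinate algebra FILE C consumes — everything about the FRAME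
COORDINATE `X_u := (blk u).toBlocks₁₂` of ★ D9 `mem_unipDelta_iff_conj` (`E₁ · blk u · E₂ = (1 X_u; 0 1)`):
* §1 (any rank `n`) `toBlocks₁₂_eq_of_frame` (a frame equation determines `X_u`) and `toBlocks₁₂_blk_mem_range_algebraMap` (rational points have principal coordinates,
  ★ `coe_toAdelic`); additivity `X_{uv} = X_u + X_v`, `X_1 = 0`, `X_{u⁻¹} = −X_u` and continuity are ★ `K2LiuSiegelUnipotentCharacters.toBlocks₁₂_blk_mul ∕ _one ∕ _inv ∕
  continuous_toBlocks₁₂_blk` (imported, used by name);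
* §2 (`n = 2`, the datum of #41) `exists_gramRA_eq_diagonal` (`T_𝔸 = diag(t₀, t₁)` with `tᵢ` units), **`conjAdele_toBlocks₁₂_diag_eq_neg`** (the diagonal entries of `X_u` are
  ANTI-INVARIANT: `σ(X_ii) = −X_ii`, from ★ `skew_of_mem_unipDelta`), **`skew_single`** (the corner line: `single i i x` is `T_𝔸`-skew iff-direction `σ x = −x`);
* §3 (the anti-invariant adeles) `conjAdele_baseChange_mul_delta` (`σ((b⊗1)δ) = −(b⊗1)δ`), **`baseChange_im_mul_delta`** (for `σ x = −x`: `x = (im x ⊗ 1)·δ` with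
  `im x := (Ψ_𝔸⁻¹ x).2`, ★ `quadraticAdeleEquiv`), `im_baseChange_mul_delta` (`im((b⊗1)δ) = b`), `continuous_im`, `im_add` — the continuous coordinate
  `{σ x = −x} ≅ 𝔸_{L⁺}` of the corner line.
References: [GelbartPiatetskishapiroRallis1987] Part A §1 (`N = {n(X)}`); [HarrisKudlaSweet1996] §1 (1.11)–(1.12); [MoeglinWaldspurger1995] II.1.7; [CasselsFrohlichANT1967] Ch. II §10.
HONEST LABEL.  Count-neutral helper: `HC_CM` is proved only modulo the 7 printed citations (2 remaining named inputs: hLiu418 = `stmt-HodgeConjecture-24832`,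
h413 = `stmt-HodgeConjecture-24833`) until rung 0 closes.
-/

set_option autoImplicit false
set_option linter.dupNamespace false -- the mandated namespace repeats `HodgeConjecture.HodgeConjecture`

noncomputable section

open scoped Matrix
open NumberField IsDedekindDomain
open Literature.NumberTheory.Automorphic Literature.NumberTheory.Automorphic.UnitaryGroup Literature.NumberTheory.GaloisRepresentations
open Literature.NumberTheory.GelbartRogawski1991 Literature.NumberTheory.GelbartRogawski1991.GRConstruction
open Literature.NumberTheory.K2Lit.SiegelDoubled
open UnitaryDualPair
open Literature.NumberTheory.Automorphic.DoubledUnitary.RankOneReduction (mem_range_toAdelic_iff)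
open Summit.HodgeConjecture.HodgeConjecture.Cruxes.HLiu418.K2LiuUnipotentChart (exists_unipChart)
open Summit.HodgeConjecture.HodgeConjecture.Cruxes.HLiu418.K2LiuUnipotentChart (skew_of_mem_unipDelta)
open Summit.HodgeConjecture.HodgeConjecture.Cruxes.HLiu418.K2LiuSiegelMiddleCellLeviCriterion (exists_gramR_eq_diagonal)
open Summit.HodgeConjecture.HodgeConjecture.Cruxes.HLiu418.K2LiuSiegelUnipotentCharacters (toBlocks₁₂_blk_mul toBlocks₁₂_blk_one toBlocks₁₂_blk_inv continuous_toBlocks₁₂_blk)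

namespace Summit.HodgeConjecture.HodgeConjecture.Cruxes.HLiu418.K2LiuUnipDeltaCornerCoordinates

variable (L : Type) [Field L] [NumberField L] [IsCMField L]

/-! ## §1 The frame coordinate `X_u = (blk u)₁₂` (any rank) -/

section AnyRank

variable {N M n : ℕ} (e : Fin N × Fin M ≃ Fin n)
  (dV : Fin N → L) (hdV : ∀ i, IsCMField.complexConj L (dV i) = dV i)
  (dW : Fin M → L) (hdW : ∀ i, IsCMField.complexConj L (dW i) = dW i)

/-- **a frame equation determines the coordinate**: `E₁ · blk u · E₂ = (1 X; 0 1) → (blk u)₁₂ = X` (the `₁₂` block of `E₁ A E₂` is `A₁₂`, ★ `conjE_eq`).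
[cite: HarrisKudlaSweet1996, §1 (1.12)] -/
theorem toBlocks₁₂_eq_of_frame (u : HA L e dV hdV dW hdW) {X : Matrix (Fin n) (Fin n) (AdeleRing (𝓞 L) L)}
    (h : Matrix.fromBlocks (1 : Matrix (Fin n) (Fin n) (AdeleRing (𝓞 L) L)) 0 (-1) 1 * blk L e dV hdV dW hdW u * Matrix.fromBlocks 1 0 1 1 =
      Matrix.fromBlocks 1 X 0 1) :
    (blk L e dV hdV dW hdW u).toBlocks₁₂ = X := by
  have h12 := congrArg Matrix.toBlocks₁₂ h
  rwa [conjE_eq, Matrix.toBlocks_fromBlocks₁₂, Matrix.toBlocks_fromBlocks₁₂] at h12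

/-- **rational points have principal coordinates**: for `u ∈ H(L⁺)` every entry of `X_u` is a principal adele (★ `coe_toAdelic`: the matrix of `toAdelic γ` is `γ ⊗ 1`).
[cite: CasselsFrohlichANT1967, Ch. II §14] -/
theorem toBlocks₁₂_blk_mem_range_algebraMap {u : HA L e dV hdV dW hdW} (hu : u ∈ ratH L e dV hdV dW hdW) (i j : Fin n) :
    (blk L e dV hdV dW hdW u).toBlocks₁₂ i j ∈ Set.range (algebraMap L (AdeleRing (𝓞 L) L)) := by
  obtain ⟨γ, rfl⟩ := hu
  refine ⟨((γ : GL (Fin (n + n)) L) : Matrix (Fin (n + n)) (Fin (n + n)) L) (e₂ (n := n) (Sum.inl i)) (e₂ (n := n) (Sum.inr j)), ?_⟩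
  show _ = (((UnitaryGroup.toAdelic (Fp L) L (IsCMField.complexConj L) (n + n) (hermD L e dV hdV dW hdW) γ : HA L e dV hdV dW hdW) :
      GL (Fin (n + n)) (AdeleRing (𝓞 L) L)) : Matrix (Fin (n + n)) (Fin (n + n)) (AdeleRing (𝓞 L) L)) (e₂ (n := n) (Sum.inl i)) (e₂ (n := n) (Sum.inr j))
  rfl

end AnyRank

/-! ## §2 `n = 2`: the Gram matrix is diagonal with unit entries; the diagonal coordinates are anti-invariant; the corner line is skew -/

section Two

variable {N M : ℕ} (e : Fin N × Fin M ≃ Fin 2)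
  (dV : Fin N → L) (hdV : ∀ i, IsCMField.complexConj L (dV i) = dV i)
  (dW : Fin M → L) (hdW : ∀ i, IsCMField.complexConj L (dW i) = dW i)

/-- **`T_𝔸 = diag(t₀, t₁)` with `tᵢ ≠ 0` in `L⁺`** (★ `exists_gramR_eq_diagonal`; non-degeneracy from ★ `isUnit_det_gramR₀`). [cite: GelbartRogawski1991, §3.1 Prop. 3.1.1 p. 455] -/
theorem exists_gramRA_eq_diagonal (hdV0 : ∀ i, dV i ≠ 0) (hdW0 : ∀ i, dW i ≠ 0) :
    ∃ t : Fin 2 → Fp L, (∀ i, t i ≠ 0) ∧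
      (gramR L e dV hdV dW hdW).map ((algebraMap L (AdeleRing (𝓞 L) L)).comp (algebraMap (Fp L) L)) =
        Matrix.diagonal fun i => ((algebraMap L (AdeleRing (𝓞 L) L)).comp (algebraMap (Fp L) L)) (t i) := by
  obtain ⟨t, ht⟩ := exists_gramR_eq_diagonal L e dV hdV dW hdW
  have hdet : IsUnit (gramR L e dV hdV dW hdW).det := by
    unfold gramR
    exact isUnit_det_gram (Fp L) e (isUnit_det_realDiagonal L dV hdV hdV0) (isUnit_det_realDiagonal L dW hdW hdW0)
  rw [ht, Matrix.det_diagonal] at hdet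
  refine ⟨t, fun i hi => ?_, by rw [ht, Matrix.diagonal_map (map_zero _)]⟩
  exact not_isUnit_zero ((Finset.prod_eq_zero (Finset.mem_univ i) hi) ▸ hdet)

/-- **THE DIAGONAL ENTRIES OF `X_u` ARE ANTI-INVARIANT**: for `u ∈ N_Δ(𝔸)` and `i ∈ {0, 1}`, `σ(X_u i i) = −X_u i i` — the `(i,i)` entry of the skewness relation
`T_𝔸 X + σ(X)ᵀ T_𝔸 = 0` (★ `skew_of_mem_unipDelta`) for diagonal `T_𝔸` with unit entries. [cite: HarrisKudlaSweet1996, §1 (1.12)] [cite: GelbartPiatetskishapiroRallis1987, Part A §1] -/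
theorem conjAdele_toBlocks₁₂_diag_eq_neg (hdV0 : ∀ i, dV i ≠ 0) (hdW0 : ∀ i, dW i ≠ 0) {u : HA L e dV hdV dW hdW} (hu : u ∈ unipDelta L e dV hdV dW hdW)
    (i : Fin 2) :
    conjAdele (Fp L) L (IsCMField.complexConj L) ((blk L e dV hdV dW hdW u).toBlocks₁₂ i i) = -((blk L e dV hdV dW hdW u).toBlocks₁₂ i i) := by
  obtain ⟨t, ht0, hT⟩ := exists_gramRA_eq_diagonal L e dV hdV dW hdW hdV0 hdW0
  have hskew := skew_of_mem_unipDelta L e dV hdV dW hdW hu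
  rw [hT] at hskew
  have hii := congrFun (congrFun hskew i) i
  rw [Matrix.add_apply, Matrix.diagonal_mul, Matrix.mul_diagonal, Matrix.transpose_apply, Matrix.map_apply, Matrix.zero_apply] at hii
  -- `tᵢ · X_ii + σ(X_ii) · tᵢ = 0` with `tᵢ` a unit
  have hti : IsUnit (((algebraMap L (AdeleRing (𝓞 L) L)).comp (algebraMap (Fp L) L)) (t i)) := (IsUnit.mk0 _ (ht0 i)).map _
  have h2 : ((algebraMap L (AdeleRing (𝓞 L) L)).comp (algebraMap (Fp L) L)) (t i) *
      (conjAdele (Fp L) L (IsCMField.complexConj L) ((blk L e dV hdV dW hdW u).toBlocks₁₂ i i) + (blk L e dV hdV dW hdW u).toBlocks₁₂ i i) = 0 := by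
    rw [mul_add, mul_comm _ (conjAdele (Fp L) L (IsCMField.complexConj L) _), add_comm]
    exact hii
  exact eq_neg_of_add_eq_zero_left ((hti.mul_right_eq_zero).1 h2)

/-- **THE CORNER LINE IS SKEW**: for an anti-invariant `x` (`σ x = −x`) the matrix `single i i x` is `T_𝔸`-skew-hermitian, `T_𝔸 · S + σ(S)ᵀ · T_𝔸 = 0` (diagonal `T_𝔸`), so
★ `exists_unipChart` turns it into an element of `N_Δ(𝔸)`. [cite: GelbartPiatetskishapiroRallis1987, Part A §1] [cite: HarrisKudlaSweet1996, §1 (1.12)] -/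
theorem skew_single (hdV0 : ∀ i, dV i ≠ 0) (hdW0 : ∀ i, dW i ≠ 0) (i : Fin 2) {x : AdeleRing (𝓞 L) L}
    (hx : conjAdele (Fp L) L (IsCMField.complexConj L) x = -x) :
    (gramR L e dV hdV dW hdW).map ((algebraMap L (AdeleRing (𝓞 L) L)).comp (algebraMap (Fp L) L)) * Matrix.single i i x +
      ((Matrix.single i i x).map (conjAdele (Fp L) L (IsCMField.complexConj L)))ᵀ *
        (gramR L e dV hdV dW hdW).map ((algebraMap L (AdeleRing (𝓞 L) L)).comp (algebraMap (Fp L) L)) = 0 := by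
  obtain ⟨t, -, hT⟩ := exists_gramRA_eq_diagonal L e dV hdV dW hdW hdV0 hdW0
  rw [hT, Matrix.map_single, hx, Matrix.transpose_single]
  ext a b
  rw [Matrix.add_apply, Matrix.diagonal_mul, Matrix.mul_diagonal, Matrix.zero_apply]
  by_cases hab : i = a ∧ i = b
  · obtain ⟨rfl, rfl⟩ := hab
    rw [Matrix.single_apply_same, Matrix.single_apply_same, neg_mul, mul_comm x, add_neg_cancel]
  · rw [Matrix.single_apply_of_ne (h := hab), Matrix.single_apply_of_ne (h := hab), mul_zero, zero_mul, add_zero]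

end Two

/-! ## §3 The anti-invariant adeles `{σ x = −x} = (𝔸_{L⁺} ⊗ 1) · δ` and their continuous coordinate -/

section Line

/-- `σ` fixes `𝔸_{L⁺} ⊗ 1 ⊆ 𝔸_L` (★ `AdeleRing.smul_baseChange`). [folklore] -/
theorem conjAdele_baseChange' (b : AdeleRing (𝓞 (Fp L)) (Fp L)) :
    conjAdele (Fp L) L (IsCMField.complexConj L) (AdeleRing.baseChange (Fp L) L b) = AdeleRing.baseChange (Fp L) L b := by
  rw [conjAdele_apply, AdeleRing.smul_baseChange]

/-- **`σ((b ⊗ 1) · δ) = −(b ⊗ 1) · δ`** (`σ` fixes `𝔸_{L⁺} ⊗ 1`, `σ δ = −δ`; ★ `conjAdele_delta_mul_baseChange_add`). [cite: CasselsFrohlichANT1967, Ch. II §10] -/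
theorem conjAdele_baseChange_mul_delta (b : AdeleRing (𝓞 (Fp L)) (Fp L)) :
    conjAdele (Fp L) L (IsCMField.complexConj L) (AdeleRing.baseChange (Fp L) L b * algebraMap L (AdeleRing (𝓞 L) L) (imagUnit L)) =
      -(AdeleRing.baseChange (Fp L) L b * algebraMap L (AdeleRing (𝓞 L) L) (imagUnit L)) := by
  have h := DoubledUnitary.RankOneReduction.conjAdele_delta_mul_baseChange_add (Fp L) L (IsCMField.complexConj L) (imagUnit L)
    (complexConj_imagUnit L) b
  rw [mul_comm (algebraMap L (AdeleRing (𝓞 L) L) (imagUnit L)) (AdeleRing.baseChange (Fp L) L b)] at h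
  exact eq_neg_of_add_eq_zero_left h

/-- `(Ψ_𝔸⁻¹ ((b ⊗ 1) · δ)) = (0, b)`: **the coordinate of a point of the corner line** (★ `quadraticAdeleEquiv_apply`, injectivity). [cite: CasselsFrohlichANT1967, Ch. II §10] -/
theorem quadraticAdeleEquiv_symm_baseChange_mul_delta (b : AdeleRing (𝓞 (Fp L)) (Fp L)) :
    (quadraticAdeleEquiv (Fp L) L (IsCMField.complexConj L) (complexConj_imagUnit L) (imagUnit_ne_zero L)).symm
        (AdeleRing.baseChange (Fp L) L b * algebraMap L (AdeleRing (𝓞 L) L) (imagUnit L)) = (0, b) := by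
  apply (quadraticAdeleEquiv (Fp L) L (IsCMField.complexConj L) (complexConj_imagUnit L) (imagUnit_ne_zero L)).injective
  rw [ContinuousAddEquiv.apply_symm_apply, quadraticAdeleEquiv_apply, map_zero, zero_add]

/-- **an anti-invariant adele lies on the corner line**: if `σ x = −x` then `x = (im x ⊗ 1) · δ` with `im x := (Ψ_𝔸⁻¹ x).2` (write `x = (a ⊗ 1) + (b ⊗ 1)δ`; then `σ x = (a ⊗ 1) − (b ⊗ 1)δ = −x`
forces `2 (a ⊗ 1) = 0`, hence `a = 0`). [cite: CasselsFrohlichANT1967, Ch. II §10] -/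
theorem baseChange_im_mul_delta {x : AdeleRing (𝓞 L) L} (hx : conjAdele (Fp L) L (IsCMField.complexConj L) x = -x) :
    AdeleRing.baseChange (Fp L) L
        ((quadraticAdeleEquiv (Fp L) L (IsCMField.complexConj L) (complexConj_imagUnit L) (imagUnit_ne_zero L)).symm x).2 *
      algebraMap L (AdeleRing (𝓞 L) L) (imagUnit L) = x := by
  set Ψ := quadraticAdeleEquiv (Fp L) L (IsCMField.complexConj L) (complexConj_imagUnit L) (imagUnit_ne_zero L) with hΨ
  set p := Ψ.symm x with hp
  have hxp : x = AdeleRing.baseChange (Fp L) L p.1 + AdeleRing.baseChange (Fp L) L p.2 * algebraMap L (AdeleRing (𝓞 L) L) (imagUnit L) := by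
    rw [← quadraticAdeleEquiv_apply (E := L) (IsCMField.complexConj L) (complexConj_imagUnit L) (imagUnit_ne_zero L), ← hΨ, hp,
      ContinuousAddEquiv.apply_symm_apply]
  -- `σ x = a − bδ` and `σ x = −x = −a − bδ` ⇒ `a = −a`
  have hσx : conjAdele (Fp L) L (IsCMField.complexConj L) x =
      AdeleRing.baseChange (Fp L) L p.1 - AdeleRing.baseChange (Fp L) L p.2 * algebraMap L (AdeleRing (𝓞 L) L) (imagUnit L) := by
    rw [hxp, map_add, conjAdele_baseChange' L, conjAdele_baseChange_mul_delta, ← sub_eq_add_neg]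
  have ha : AdeleRing.baseChange (Fp L) L p.1 + AdeleRing.baseChange (Fp L) L p.1 = 0 := by
    have h1 := hσx.symm.trans hx
    rw [hxp, neg_add, sub_eq_add_neg, add_left_inj] at h1
    nth_rewrite 2 [h1]
    exact add_neg_cancel _
  have ha0 : AdeleRing.baseChange (Fp L) L p.1 = 0 := by
    rw [← two_mul, ← map_ofNat (AdeleRing.baseChange (Fp L) L) 2, ← map_mul, map_eq_zero_iff _ (AdeleRing.baseChange_injective (F := Fp L) (E := L))] at ha
    have h2 : (2 : AdeleRing (𝓞 (Fp L)) (Fp L)) = algebraMap (Fp L) (AdeleRing (𝓞 (Fp L)) (Fp L)) 2 := by rw [map_ofNat]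
    rw [h2] at ha
    have hu : IsUnit (algebraMap (Fp L) (AdeleRing (𝓞 (Fp L)) (Fp L)) 2) := (IsUnit.mk0 (2 : Fp L) two_ne_zero).map _
    have := (hu.mul_right_eq_zero).1 ha
    rw [this, map_zero]
  conv_rhs => rw [hxp, ha0, zero_add]

/-- the coordinate `im x := (Ψ_𝔸⁻¹ x).2` is continuous. [folklore] -/
theorem continuous_im :
    Continuous fun x : AdeleRing (𝓞 L) L =>
      ((quadraticAdeleEquiv (Fp L) L (IsCMField.complexConj L) (complexConj_imagUnit L) (imagUnit_ne_zero L)).symm x).2 :=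
  continuous_snd.comp (quadraticAdeleEquiv (Fp L) L (IsCMField.complexConj L) (complexConj_imagUnit L) (imagUnit_ne_zero L)).symm.continuous

/-- the coordinate `im` is additive. [folklore] -/
theorem im_add (x y : AdeleRing (𝓞 L) L) :
    ((quadraticAdeleEquiv (Fp L) L (IsCMField.complexConj L) (complexConj_imagUnit L) (imagUnit_ne_zero L)).symm (x + y)).2 =
      ((quadraticAdeleEquiv (Fp L) L (IsCMField.complexConj L) (complexConj_imagUnit L) (imagUnit_ne_zero L)).symm x).2 +
        ((quadraticAdeleEquiv (Fp L) L (IsCMField.complexConj L) (complexConj_imagUnit L) (imagUnit_ne_zero L)).symm y).2 := by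
  rw [map_add, Prod.snd_add]

/-- `im ((b ⊗ 1) · δ) = b`. [folklore] -/
theorem im_baseChange_mul_delta (b : AdeleRing (𝓞 (Fp L)) (Fp L)) :
    ((quadraticAdeleEquiv (Fp L) L (IsCMField.complexConj L) (complexConj_imagUnit L) (imagUnit_ne_zero L)).symm
        (AdeleRing.baseChange (Fp L) L b * algebraMap L (AdeleRing (𝓞 L) L) (imagUnit L))).2 = b := by
  rw [quadraticAdeleEquiv_symm_baseChange_mul_delta]

/-- `t ↦ (t ⊗ 1) · δ` is continuous (★ `AdeleRing.continuous_baseChange`). [folklore] -/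
theorem continuous_baseChange_mul_delta :
    Continuous fun t : AdeleRing (𝓞 (Fp L)) (Fp L) => AdeleRing.baseChange (Fp L) L t * algebraMap L (AdeleRing (𝓞 L) L) (imagUnit L) :=
  (AdeleRing.continuous_baseChange (F := Fp L) (E := L)).mul continuous_const

end Line

/-! ## §4 `n = 2`: THE CORNER ONE-PARAMETER SUBGROUP `n₂ : 𝔸_{L⁺} → N_Δ(𝔸)`, `n₂ t = n((0 0; 0 (t⊗1)δ))` -/

section Corner

variable {N M : ℕ} (e : Fin N × Fin M ≃ Fin 2)
  (dV : Fin N → L) (hdV : ∀ i, IsCMField.complexConj L (dV i) = dV i)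
  (dW : Fin M → L) (hdW : ∀ i, IsCMField.complexConj L (dW i) = dW i)

/-- `t ↦ single 1 1 ((t ⊗ 1) δ)` is continuous. [folklore] -/
theorem continuous_single_baseChange_mul_delta :
    Continuous fun t : AdeleRing (𝓞 (Fp L)) (Fp L) =>
      (Matrix.single (1 : Fin 2) (1 : Fin 2) (AdeleRing.baseChange (Fp L) L t * algebraMap L (AdeleRing (𝓞 L) L) (imagUnit L)) :
        Matrix (Fin 2) (Fin 2) (AdeleRing (𝓞 L) L)) := by
  refine continuous_matrix fun i j => ?_
  simp only [Matrix.single, Matrix.of_apply]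
  split_ifs
  · exact continuous_baseChange_mul_delta L
  · exact continuous_const

/-- **THE CORNER ONE-PARAMETER SUBGROUP** (the (β0-1a) letters `n₂ ∕ hn₂` of K2Liu-p14's ★ `inner_law_of_unfold`, PROVED from ★ `exists_unipChart`): for the rank-`2` doubled datum
there is `n₂ : 𝔸_{L⁺} → H(𝔸)`, CONTINUOUS, ADDITIVE (`n₂ (s + t) = n₂ s · n₂ t`, `n₂ 0 = 1`), with values in `N_Δ(𝔸)`, whose frame coordinate is the corner `X_{n₂ t} = single 1 1 ((t ⊗ 1) δ)`
(so `(X_{n₂ t})₁₁ = (t ⊗ 1) δ` and `im (X_{n₂ t})₁₁ = t`), RATIONAL on `L⁺` (`n₂ (t ⊗ 1) ∈ H(L⁺)`), and ONTO the corner line: every `u ∈ N_Δ(𝔸)` whose coordinate is supported at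
`(1,1)` is `n₂ (im (X_u)₁₁)`. [cite: GelbartPiatetskishapiroRallis1987, Part A §1] [cite: MoeglinWaldspurger1995, II.1.7] [cite: KudlaRallis1994, §2] -/
theorem exists_cornerSubgroup (hdV0 : ∀ i, dV i ≠ 0) (hdW0 : ∀ i, dW i ≠ 0) :
    ∃ n₂ : AdeleRing (𝓞 (Fp L)) (Fp L) → HA L e dV hdV dW hdW,
      Continuous n₂ ∧ (∀ s t, n₂ (s + t) = n₂ s * n₂ t) ∧ n₂ 0 = 1 ∧
      (∀ t, n₂ t ∈ unipDelta L e dV hdV dW hdW) ∧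
      (∀ t, (blk L e dV hdV dW hdW (n₂ t)).toBlocks₁₂ =
        Matrix.single (1 : Fin 2) (1 : Fin 2) (AdeleRing.baseChange (Fp L) L t * algebraMap L (AdeleRing (𝓞 L) L) (imagUnit L))) ∧
      (∀ t : Fp L, n₂ (algebraMap (Fp L) (AdeleRing (𝓞 (Fp L)) (Fp L)) t) ∈ ratH L e dV hdV dW hdW) ∧
      (∀ u : HA L e dV hdV dW hdW, u ∈ unipDelta L e dV hdV dW hdW →
        (blk L e dV hdV dW hdW u).toBlocks₁₂ = Matrix.single (1 : Fin 2) (1 : Fin 2) ((blk L e dV hdV dW hdW u).toBlocks₁₂ 1 1) →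
        n₂ ((quadraticAdeleEquiv (Fp L) L (IsCMField.complexConj L) (complexConj_imagUnit L) (imagUnit_ne_zero L)).symm
          ((blk L e dV hdV dW hdW u).toBlocks₁₂ 1 1)).2 = u) := by
  obtain ⟨Φ, hΦc, hΦadd, hΦmem, hΦsurj, hΦrat⟩ := exists_unipChart L e dV hdV dW hdW
  -- the corner matrices `X t = single 1 1 ((t ⊗ 1) δ)` are skew
  set x : AdeleRing (𝓞 (Fp L)) (Fp L) → AdeleRing (𝓞 L) L := fun t => AdeleRing.baseChange (Fp L) L t * algebraMap L (AdeleRing (𝓞 L) L) (imagUnit L) with hxdef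
  set X : AdeleRing (𝓞 (Fp L)) (Fp L) → Matrix (Fin 2) (Fin 2) (AdeleRing (𝓞 L) L) := fun t => Matrix.single (1 : Fin 2) (1 : Fin 2) (x t) with hXdef
  have hskew : ∀ t, (gramR L e dV hdV dW hdW).map ((algebraMap L (AdeleRing (𝓞 L) L)).comp (algebraMap (Fp L) L)) * X t +
      ((X t).map (conjAdele (Fp L) L (IsCMField.complexConj L)))ᵀ * (gramR L e dV hdV dW hdW).map ((algebraMap L (AdeleRing (𝓞 L) L)).comp (algebraMap (Fp L) L)) = 0 :=
    fun t => skew_single L e dV hdV dW hdW hdV0 hdW0 1 (conjAdele_baseChange_mul_delta L t)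
  have hXadd : ∀ s t, X (s + t) = X s + X t := fun s t => by
    simp only [hXdef, hxdef, map_add, add_mul, Matrix.single_add]
  -- the map
  let n₂ : AdeleRing (𝓞 (Fp L)) (Fp L) → HA L e dV hdV dW hdW := fun t => ⟨Φ (X t), (hΦmem (X t) (hskew t)).fst⟩
  have hn₂coe : ∀ t, ((n₂ t : HA L e dV hdV dW hdW) : GL (Fin (2 + 2)) (AdeleRing (𝓞 L) L)) = Φ (X t) := fun t => rfl
  have hmem : ∀ t, n₂ t ∈ unipDelta L e dV hdV dW hdW := fun t => (hΦmem (X t) (hskew t)).snd.1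
  have hframe : ∀ t, (blk L e dV hdV dW hdW (n₂ t)).toBlocks₁₂ = X t := fun t =>
    toBlocks₁₂_eq_of_frame L e dV hdV dW hdW (n₂ t) (hΦmem (X t) (hskew t)).snd.2
  have hadd : ∀ s t, n₂ (s + t) = n₂ s * n₂ t := fun s t => Subtype.ext (by
    show Φ (X (s + t)) = Φ (X s) * Φ (X t)
    rw [hXadd, hΦadd])
  have hzero : n₂ 0 = 1 := by
    have h := hadd 0 0
    rw [add_zero] at h
    exact (mul_eq_left.1 h.symm)
  refine ⟨n₂, ?_, hadd, hzero, hmem, hframe, fun t => ?_, fun u hu hX => ?_⟩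
  · -- continuity
    exact Continuous.subtype_mk (hΦc.comp (continuous_single_baseChange_mul_delta L)) _
  · -- rationality: `X (t ⊗ 1) = (single 1 1 (t δ)) ⊗ 1`
    refine (mem_range_toAdelic_iff (Fp L) L (IsCMField.complexConj L) (hermD L e dV hdV dW hdW) _).2 ?_
    have hXrat : X (algebraMap (Fp L) (AdeleRing (𝓞 (Fp L)) (Fp L)) t) =
        (Matrix.single (1 : Fin 2) (1 : Fin 2) (algebraMap (Fp L) L t * imagUnit L)).map (algebraMap L (AdeleRing (𝓞 L) L)) := by
      rw [Matrix.map_single, map_mul]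
      simp only [hXdef, hxdef, AdeleRing.baseChange_algebraMap]
    rw [hn₂coe, hXrat]
    exact hΦrat _
  · -- surjectivity onto the corner line
    have hanti := conjAdele_toBlocks₁₂_diag_eq_neg L e dV hdV dW hdW hdV0 hdW0 hu 1
    have hxim : x (((quadraticAdeleEquiv (Fp L) L (IsCMField.complexConj L) (complexConj_imagUnit L) (imagUnit_ne_zero L)).symm
        ((blk L e dV hdV dW hdW u).toBlocks₁₂ 1 1)).2) = (blk L e dV hdV dW hdW u).toBlocks₁₂ 1 1 := baseChange_im_mul_delta L hanti
    refine Subtype.ext ?_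
    rw [hn₂coe]
    show Φ (Matrix.single 1 1 (x _)) = _
    rw [hxim, ← hX]
    exact hΦsurj u hu

end Corner

end Summit.HodgeConjecture.HodgeConjecture.Cruxes.HLiu418.K2LiuUnipDeltaCornerCoordinates

end
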